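import Summits.QuantumAdvantage.AdviceFreeQNC0.KFeatureWindow
import Summits.QuantumAdvantage.AdviceFreeQNC0.CrossFreeWindowPolylog
import Summits.QuantumAdvantage.AdviceFreeQNC0.UnionBoundLift
import HarnessLib

/-!
# Cell qa-qnc0 (rung F-Q1, route RingFrame, crux α `RingToElim`): LOCAL RULES WITH GLOBAL PARITIES
# are beaten (corollary (b) of planner qa-qnc0-p1's T9, ask P13 `ringWinU_localRulesWithParities_le`)

The local-rules theorem (`ringWinU_localRules_le`) beats every walk strategy whose selectors read
only a window of polylog RANGE around their cut.  The K-feature window theorem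
(`kFeatureWindowSqrt`) lets the selectors also read a bounded number of GLOBAL PARITIES: the
dependence of a `z`-interior cut on the far `x`-block is then carried by the `K` parities
restricted to `x` — features of degree `1` — so the PLDAMS budget is `K·D ≤ c₁√L`.

* `xor_eq_of_hasDeg_one` — an affine (`HasDeg · 1`) Boolean function `ℓ` satisfies
  `ℓ u ⊕ ℓ u' = ℓ v ⊕ ℓ v'` whenever `u ⊕ u' = v ⊕ v'` pointwise (`eq_affine_of_mem_lowDeg_one`);
* `ringWinU_localRulesWithParities_sqrt_le` — window `a ++ x ++ h ++ z ++ b` (`L, M ≥ n₀`,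
  `D ≤ c₁√M`, `K·D ≤ c₁√L`, `1 ≤ D`): if every cut strictly inside the `z`-block is a LOCAL RULE
  of range `r ≤ H` XOR a parity of a subset of `K` fixed affine functions `ℓ_k` of the input, and
  every selector has degree `≤ D`, then `#WIN ≤ θ·2ⁿ` (`θ` of T9);
* `ringWinU_localRulesWithParities_le` — the polylog form: degree and range `(log₂ n)^C`,
  `L, M ≥ (log₂ n)^{2C+1}`, `H ≥ (log₂ n)^C`, `K·(log₂ n)^C ≤ c₁√L` (so `K` up to `c₁√L/(log₂ n)^C`,
  e.g. `≍ √n/polylog` for `L ≍ n/2`).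

The cell's theorem (planner qa-qnc0-p1 gen 11, ask P13(b); prover qn-prover-3 gen 4),
2026-08-27; not in print.  WHAT THIS IS NOT: general cross-reading (α proper) untouched; the
budget is the atom fence; no separation.
-/

noncomputable section

namespace Summit.QuantumAdvantage.AdviceFreeQNC0

open Finset
open Literature.Computability.MetaComplexity Literature.Computability.MetaComplexity.Smolensky

/-! ### Affine Boolean functions -/

/-- **Affine functions see only the difference**: if `ℓ` has degree `≤ 1` and `u ⊕ u' = v ⊕ v'`
pointwise then `ℓ u ⊕ ℓ u' = ℓ v ⊕ ℓ v'`. -/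
theorem xor_eq_of_hasDeg_one {n : ℕ} {ℓ : (Fin n → Bool) → Bool} (hℓ : HasDeg ℓ 1)
    (u u' v v' : Fin n → Bool) (h : ∀ i, xor (u i) (u' i) = xor (v i) (v' i)) :
    xor (ℓ u) (ℓ u') = xor (ℓ v) (ℓ v') := by
  classical
  set g : CubeFn (ZMod 2) n := fun w => if ℓ w = true then 1 else 0 with hg
  have hg1 : g ∈ lowDeg (ZMod 2) n 1 := hℓ
  have key : ∀ w w' : Fin n → Bool, g w + g w' =
      ∑ i, ((if w i = true then (1 : ZMod 2) else 0) + (if w' i = true then 1 else 0)) *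
        (g (basisRow i) + g (fun _ => false)) := by
    intro w w'
    rw [eq_affine_of_mem_lowDeg_one hg1 w, eq_affine_of_mem_lowDeg_one hg1 w']
    have h2 : g (fun _ => false) + g (fun _ => false) = 0 := by
      have hall : ∀ a : ZMod 2, a + a = 0 := by decide
      exact hall _
    simp only [add_mul, Finset.sum_add_distrib]
    calc g (fun _ => false) + ∑ i, (if w i = true then (1 : ZMod 2) else 0) * (g (basisRow i) + g fun _ => false)
          + (g (fun _ => false) + ∑ i, (if w' i = true then (1 : ZMod 2) else 0) * (g (basisRow i) + g fun _ => false))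
        = (g (fun _ => false) + g (fun _ => false))
          + (∑ i, (if w i = true then (1 : ZMod 2) else 0) * (g (basisRow i) + g fun _ => false)
            + ∑ i, (if w' i = true then (1 : ZMod 2) else 0) * (g (basisRow i) + g fun _ => false)) := by ring
      _ = _ := by rw [h2, zero_add]
  have hdiff : ∀ i, ((if u i = true then (1 : ZMod 2) else 0) + (if u' i = true then 1 else 0)) =
      ((if v i = true then (1 : ZMod 2) else 0) + (if v' i = true then 1 else 0)) := by
    intro i
    have hi := h i
    revert hi
    cases u i <;> cases u' i <;> cases v i <;> cases v' i <;> decide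
  have hsum : g u + g u' = g v + g v' := by
    rw [key u u', key v v']
    exact Finset.sum_congr rfl fun i _ => by rw [hdiff i]
  have hval : ∀ w w' : Fin n → Bool, g w + g w' = if xor (ℓ w) (ℓ w') = true then 1 else 0 := by
    intro w w'
    simp only [hg]
    cases ℓ w <;> cases ℓ w' <;> decide
  rw [hval, hval] at hsum
  revert hsum
  cases xor (ℓ u) (ℓ u') <;> cases xor (ℓ v) (ℓ v') <;> simp

variable {p L H M q : ℕ}

/-- Two nested-glued inputs differing only in the `x`-block have the same pointwise XOR whatever
the other blocks are. -/
theorem xor_glue3_glue3_eq (a a' : Fin p → Bool) (x x' : Fin L → Bool) (h h' : Fin H → Bool)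
    (z z' : Fin M → Bool) (b b' : Fin q → Bool) (i : Fin (p + (L + H + M) + q)) :
    xor (glue3 a (glue3 x h z) b i) (glue3 a (glue3 x' h z) b i) =
      xor (glue3 a' (glue3 x h' z') b' i) (glue3 a' (glue3 x' h' z') b' i) := by
  unfold glue3
  induction i using Fin.addCases with
  | left k =>
    simp only [Fin.append_left]
    induction k using Fin.addCases with
    | left k₀ => simp only [Fin.append_left, Bool.xor_self]
    | right k₁ =>
      simp only [Fin.append_right]
      induction k₁ using Fin.addCases with
      | left j₀ =>
        simp only [Fin.append_left]
        induction j₀ using Fin.addCases with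
        | left l₀ => simp only [Fin.append_left]
        | right l₁ => simp only [Fin.append_right, Bool.xor_self]
      | right j₁ => simp only [Fin.append_right, Bool.xor_self]
  | right k => simp only [Fin.append_right, Bool.xor_self]

/-! ### The square-root form -/

/-- **Local rules with global parities are beaten (square-root form).**  There are `θ < 1`,
`c₁ > 0`, `n₀` such that: for a window `a ++ x ++ h ++ z ++ b` with `L, M ≥ n₀`, `1 ≤ D ≤ c₁√M`,
`K·D ≤ c₁√L`, `r ≤ H`, every charge, `K` affine functions `ℓ_k` of the input, and every walk
strategy of degree `≤ D` whose cuts strictly inside the `z`-block are each a local rule of range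
`r` XOR the parity of a subset of the `ℓ_k`, the ring game in walk coordinates is won on at most
`θ·2ⁿ` inputs. [cite: Srinivasan2023, Lemma 3.1] -/
theorem ringWinU_localRulesWithParities_sqrt_le :
    ∃ θ : ℝ, θ < 1 ∧ ∃ c₁ : ℝ, 0 < c₁ ∧ ∃ n₀ : ℕ, ∀ p L H M q K r : ℕ, n₀ ≤ L → n₀ ≤ M →
      ∀ D : ℕ, 1 ≤ D → (D : ℝ) ≤ c₁ * Real.sqrt M → ((K * D : ℕ) : ℝ) ≤ c₁ * Real.sqrt L → r ≤ H →
      ∀ (c : ℕ) (ℓ : Fin K → (Fin (p + (L + H + M) + q) → Bool) → Bool), (∀ k, HasDeg (ℓ k) 1) →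
      ∀ (y : Fin (p + (L + H + M) + q + 1) → (Fin (p + (L + H + M) + q) → Bool) → Bool),
        (∀ g, HasDeg (y g) D) →
        (∀ g : Fin (p + (L + H + M) + q + 1), p + (L + H) < g.val → g.val < p + (L + H + M) →
          ∃ f : (Fin (p + (L + H + M) + q) → Bool) → Bool, ∃ S : Finset (Fin K),
            (∀ u u' : Fin (p + (L + H + M) + q) → Bool,
              (∀ i : Fin (p + (L + H + M) + q), g.val ≤ i.val + r → i.val < g.val + r → u i = u' i) →
                f u = f u') ∧
            ∀ u, y g u = xor (f u) (decide ((S.filter fun k => ℓ k u = true).card % 2 = 1))) →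
        ((univ.filter fun u : Fin (p + (L + H + M) + q) → Bool => ringWinU c y u = true).card : ℝ) ≤
          θ * (2 : ℝ) ^ (p + (L + H + M) + q) := by
  classical
  obtain ⟨θ, hθ, c₁, hc₁, n₀, HT⟩ := kFeatureWindowSqrt
  refine ⟨θ, hθ, c₁, hc₁, n₀, ?_⟩
  intro p L H M q K r hL hM D hD1 hD hKD hrH c ℓ hℓ y hdeg hloc
  refine HT p L H M q K hL hM D hD hKD c y hdeg fun a h b => ?_
  -- the features: the parities restricted to the `x`-block (reference fibre: all zeros)
  set a₀ : Fin p → Bool := fun _ => false with ha₀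
  set h₀ : Fin H → Bool := fun _ => false with hh₀
  set z₀ : Fin M → Bool := fun _ => false with hz₀
  set b₀ : Fin q → Bool := fun _ => false with hb₀
  refine ⟨fun k x => ℓ k (glue3 a₀ (glue3 x h₀ z₀) b₀), fun k => ?_, ?_⟩
  · -- degree of a feature: restriction of an affine function
    have h1 : HasDeg (fun w : Fin (L + H + M) → Bool => ℓ k (glue3 a₀ w b₀)) 1 :=
      hasDeg_glue3_window a₀ b₀ (hℓ k)
    have h2 : HasDeg (fun xh : Fin (L + H) → Bool => ℓ k (glue3 a₀ (Fin.append xh z₀) b₀)) 1 :=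
      hasDeg_append_left z₀ h1
    have h3 : HasDeg (fun x : Fin L → Bool => ℓ k (glue3 a₀ (Fin.append (Fin.append x h₀) z₀) b₀)) 1 :=
      hasDeg_append_left h₀ h2
    exact hasDeg_of_le h3 hD1
  · intro g hg1 hg2 x x' z hxx'
    obtain ⟨f, S, hf, hyg⟩ := hloc g hg1 hg2
    rw [hyg, hyg]
    -- the local part does not see the `x`-block
    have hfeq : f (glue3 a (glue3 x h z) b) = f (glue3 a (glue3 x' h z) b) :=
      hf _ _ fun i hi1 hi2 => glue3_glue3_eq_off_x a x x' h z b i (by omega)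
    -- the parities agree
    have hℓeq : ∀ k, ℓ k (glue3 a (glue3 x h z) b) = ℓ k (glue3 a (glue3 x' h z) b) := by
      intro k
      have h1 := xor_eq_of_hasDeg_one (hℓ k) (glue3 a (glue3 x h z) b) (glue3 a (glue3 x' h z) b)
        (glue3 a₀ (glue3 x h₀ z₀) b₀) (glue3 a₀ (glue3 x' h₀ z₀) b₀)
        (fun i => xor_glue3_glue3_eq a a₀ x x' h h₀ z z₀ b b₀ i)
      have hk : ℓ k (glue3 a₀ (glue3 x h₀ z₀) b₀) = ℓ k (glue3 a₀ (glue3 x' h₀ z₀) b₀) := hxx' k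
      have h2 : xor (ℓ k (glue3 a₀ (glue3 x h₀ z₀) b₀)) (ℓ k (glue3 a₀ (glue3 x' h₀ z₀) b₀)) = false := by
        rw [hk, Bool.xor_self]
      rw [h2] at h1
      revert h1
      cases ℓ k (glue3 a (glue3 x h z) b) <;> cases ℓ k (glue3 a (glue3 x' h z) b) <;> simp
    rw [hfeq]
    have hS : (S.filter fun k => ℓ k (glue3 a (glue3 x h z) b) = true) =
        S.filter fun k => ℓ k (glue3 a (glue3 x' h z) b) = true :=
      Finset.filter_congr fun k _ => by rw [hℓeq k]
    rw [hS]

/-! ### The polylog form -/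

/-- Degree bookkeeping: `k^C ≤ c₁·√L` once `c₁·√k ≥ 1` and `L ≥ k^{2C+1}`. -/
private theorem pow_le_mul_sqrt₂ {c₁ : ℝ} (hc₁ : 0 < c₁) {k C L : ℕ} (hck : 1 ≤ c₁ * Real.sqrt k)
    (hL : k ^ (2 * C + 1) ≤ L) : ((k ^ C : ℕ) : ℝ) ≤ c₁ * Real.sqrt L := by
  have hsqrt : (k : ℝ) ^ C * Real.sqrt k ≤ Real.sqrt L := by
    have h2 : ((k ^ (2 * C + 1) : ℕ) : ℝ) ≤ L := by exact_mod_cast hL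
    have h1 : ((k : ℝ) ^ C) ^ 2 * k ≤ L := by
      calc ((k : ℝ) ^ C) ^ 2 * k = (k : ℝ) ^ (2 * C + 1) := by ring
        _ ≤ L := by push_cast at h2; exact h2
    calc (k : ℝ) ^ C * Real.sqrt k = Real.sqrt (((k : ℝ) ^ C) ^ 2 * k) := by
          rw [Real.sqrt_mul (by positivity), Real.sqrt_sq (by positivity)]
      _ ≤ Real.sqrt L := Real.sqrt_le_sqrt h1
  push_cast
  calc (k : ℝ) ^ C = (k : ℝ) ^ C * 1 := (mul_one _).symm
    _ ≤ (k : ℝ) ^ C * (c₁ * Real.sqrt k) := mul_le_mul_of_nonneg_left hck (by positivity)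
    _ = c₁ * ((k : ℝ) ^ C * Real.sqrt k) := by ring
    _ ≤ c₁ * Real.sqrt L := mul_le_mul_of_nonneg_left hsqrt hc₁.le

/-- `c₁ √k ≥ 1` once `k ≥ ⌈1/c₁²⌉ + 1`. -/
private theorem one_le_mul_sqrt₂ {c₁ : ℝ} (hc₁ : 0 < c₁) {k : ℕ} (hk : ⌈1 / c₁ ^ 2⌉₊ + 1 ≤ k) :
    1 ≤ c₁ * Real.sqrt k := by
  have h2 : ((⌈1 / c₁ ^ 2⌉₊ : ℕ) : ℝ) + 1 ≤ k := by exact_mod_cast hk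
  have h3 : (1 / c₁ ^ 2 : ℝ) ≤ ((⌈1 / c₁ ^ 2⌉₊ : ℕ) : ℝ) := Nat.le_ceil _
  have h1 : (1 / c₁ ^ 2 : ℝ) ≤ k := by linarith
  rw [div_le_iff₀ (by positivity)] at h1
  calc (1 : ℝ) = Real.sqrt 1 := Real.sqrt_one.symm
    _ ≤ Real.sqrt (c₁ ^ 2 * k) := Real.sqrt_le_sqrt (by linarith)
    _ = c₁ * Real.sqrt k := by rw [Real.sqrt_mul (by positivity), Real.sqrt_sq hc₁.le]

/-- **LOCAL RULES WITH GLOBAL PARITIES (polylog form).**  There are `θ < 1` and `c₁ > 0` such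
that for every `C` and all large `n`: a walk strategy on `n` bits of degree `≤ (log₂ n)^C`
admitting a window `[p, p+L) ++ [p+L, p+L+H) ++ [p+L+H, p+L+H+M)` with `L, M ≥ (log₂ n)^{2C+1}`,
`H ≥ (log₂ n)^C`, whose cuts strictly inside the third block are local rules of range
`(log₂ n)^C` XOR parities of subsets of `K` fixed affine functions, `K·(log₂ n)^C ≤ c₁√L`, wins
on at most `θ·2ⁿ` inputs, every charge. [cite: Srinivasan2023, Lemma 3.1] -/
theorem ringWinU_localRulesWithParities_le :
    ∃ θ : ℝ, θ < 1 ∧ ∃ c₁ : ℝ, 0 < c₁ ∧ ∀ C : ℕ, ∃ n₀ : ℕ, ∀ n ≥ n₀, ∀ p L H M K : ℕ,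
      p + (L + H + M) ≤ n → (Nat.log 2 n) ^ (2 * C + 1) ≤ L → (Nat.log 2 n) ^ (2 * C + 1) ≤ M →
      (Nat.log 2 n) ^ C ≤ H → ((K * (Nat.log 2 n) ^ C : ℕ) : ℝ) ≤ c₁ * Real.sqrt L →
      ∀ (c : ℕ) (ℓ : Fin K → (Fin n → Bool) → Bool), (∀ k, HasDeg (ℓ k) 1) →
      ∀ y : Fin (n + 1) → (Fin n → Bool) → Bool, (∀ g, HasDeg (y g) ((Nat.log 2 n) ^ C)) →
        (∀ g : Fin (n + 1), p + (L + H) < g.val → g.val < p + (L + H + M) →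
          ∃ f : (Fin n → Bool) → Bool, ∃ S : Finset (Fin K),
            (∀ u u' : Fin n → Bool, (∀ i : Fin n, g.val ≤ i.val + (Nat.log 2 n) ^ C →
              i.val < g.val + (Nat.log 2 n) ^ C → u i = u' i) → f u = f u') ∧
            ∀ u, y g u = xor (f u) (decide ((S.filter fun k => ℓ k u = true).card % 2 = 1))) →
        ((univ.filter fun u : Fin n → Bool => ringWinU c y u = true).card : ℝ) ≤ θ * (2 : ℝ) ^ n := by
  obtain ⟨θ, hθ, c₁, hc₁, ℓ₀, Hsq⟩ := ringWinU_localRulesWithParities_sqrt_le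
  refine ⟨θ, hθ, c₁, hc₁, fun C => ⟨2 ^ (max (ℓ₀ + 1) (⌈1 / c₁ ^ 2⌉₊ + 1)), ?_⟩⟩
  intro n hn p L H M K hpn hL hM hH hK c ℓ hℓ y hdeg hloc
  obtain ⟨q, rfl⟩ : ∃ q, n = p + (L + H + M) + q := ⟨n - (p + (L + H + M)), by omega⟩
  set k := Nat.log 2 (p + (L + H + M) + q) with hk
  have hm : max (ℓ₀ + 1) (⌈1 / c₁ ^ 2⌉₊ + 1) ≤ k := Nat.le_log_of_pow_le one_lt_two hn
  have hkℓ : ℓ₀ + 1 ≤ k := le_trans (le_max_left _ _) hm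
  have hk1 : ⌈1 / c₁ ^ 2⌉₊ + 1 ≤ k := le_trans (le_max_right _ _) hm
  have hkk : k ≤ k ^ (2 * C + 1) := Nat.le_self_pow (by omega) k
  have hℓ₀L : ℓ₀ ≤ L := by omega
  have hℓ₀M : ℓ₀ ≤ M := by omega
  have hck := one_le_mul_sqrt₂ hc₁ hk1
  have hDM := pow_le_mul_sqrt₂ (C := C) hc₁ hck hM
  have hD1 : 1 ≤ k ^ C := Nat.one_le_pow _ _ (by omega)
  exact Hsq p L H M q K (k ^ C) hℓ₀L hℓ₀M (k ^ C) hD1 hDM hK hH c ℓ hℓ y hdeg hloc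

end Summit.QuantumAdvantage.AdviceFreeQNC0
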